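import Mathlib
import Summits.NavierStokesRegularity.NavierStokesRegularity.Theorems.EulerZoomLiouvillePowerGaugeEulerLiouvilleGalileanFrameShear
import Literature.Analysis.FluidPDE.WeakGradientIBP
import HarnessLib

/-!
# RIGID FRAMES: the time derivative of the body-frame pairing `τ ↦ ∫ ⟪R(τ) U(w), Φ(R(τ) w + ξ(τ))⟫ dw`
# (crux `EulerZoomLiouville.PowerGaugeEulerLiouville` = stmt-NavierStokesRegularity-19832; first tool of the «E(3)-steady, escaping» stratum; width seat ns-ezl-w3 g5)

Route №10 `EulerZoomLiouville` (NavierStokesRegularity), crux E.  A rigid-frame-steady member is `u(τ, x) = R(τ) U(R(τ)⁻¹(x − ξ(τ))) + η(τ)` with `C¹` paths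
`R` (linear isometries) and `ξ` (centre).  Sub-critically confined centres are killed by the `E`-gauge alone (`RigidFrame.ae_eq_zero_of_gauge_of_pastRigidFrameSteady_confined`);
for ESCAPING centres the route is the one of F1e (`GalileanFrames.frameSteadyEscaping`) with the rotation inserted: pair `u(τ)` with a fixed test field `Φ`, change
variables to the body frame, differentiate in `τ`, and read the weak Euler equation as a tested identity at every time; the two-time difference then says that the
Lie derivative of `U` along a Killing field is weakly a gradient (`Killing.screwShearVanishes`).  This file supplies the first analytic step, the rotational twin of
`GalileanFrames.hasDerivAt_integral_inner_comp_add_path`: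

* `RigidFrame.hasDerivAt_integral_inner_rigid_path` — for `U ∈ L¹_loc`, `Φ` a test field, `R ∈ C¹(ℝ; L(ℝ³))` with `‖R(τ)w‖ = ‖w‖`, `ξ ∈ C¹`:
  `d/dτ ∫ ⟪R(τ)U(w), Φ(R(τ)w + ξ(τ))⟫ dw = ∫ ⟪R′(τ)U(w), Φ(…)⟫ + ⟪R(τ)U(w), DΦ(…)(R′(τ)w + ξ′(τ))⟫ dw` (dominated differentiation; the moving support stays in
  `‖w‖ ≤ R₀ + sup|ξ|` by the isometry property);
* `RigidFrame.continuous_integral_inner_rigid_clm_path` — continuity of `τ ↦ ∫ ⟪R(τ)U(w), Ψ(R(τ)w + ξ(τ))(c(τ, w))⟫` for continuous compactly supported operator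
  fields `Ψ` and affine-in-`w` continuous coefficients `c(τ, w) = A(τ)w + a(τ)` (the shape of the derivative above).

WHAT THIS IS NOT: not NS regularity, not the crux E — a tool toward one more symmetry stratum of the crux CLASS 19832 (MODEL lattice; E/NS strata),
`--supports` stmt-19832; 19832 OPEN. [folklore]
-/

noncomputable section

-- flat `Theorems/<Route><Decl>…` files of one crux share the namespace of the crux (tree convention: `Summit.<S>.<S>.…`)
set_option linter.dupNamespace false

open MeasureTheory Set Filter Topology Metric Function TopologicalSpace InnerProductSpace
open scoped ENNReal NNReal RealInnerProductSpace ContDiff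

namespace Summit.NavierStokesRegularity.NavierStokesRegularity.Theorems.PowerGaugeEulerLiouville

namespace RigidFrame

open Literature.Analysis Literature.Analysis.FunctionSpaces Literature.Analysis.FluidPDE

variable {U : EuclideanSpace ℝ (Fin 3) → EuclideanSpace ℝ (Fin 3)} {ξ : ℝ → EuclideanSpace ℝ (Fin 3)}
  {R : ℝ → EuclideanSpace ℝ (Fin 3) →L[ℝ] EuclideanSpace ℝ (Fin 3)}

/-- Off the ball `‖w‖ ≤ R₀ + ‖ξ‖` the moving argument `R w + ξ` misses a set supported in `B̄(0, R₀)` (`R` an isometry). [folklore] -/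
theorem norm_le_of_rigid_mem {L : EuclideanSpace ℝ (Fin 3) →L[ℝ] EuclideanSpace ℝ (Fin 3)} (hL : ∀ w, ‖L w‖ = ‖w‖)
    {w c : EuclideanSpace ℝ (Fin 3)} {R₀ : ℝ} (h : ‖L w + c‖ ≤ R₀) : ‖w‖ ≤ R₀ + ‖c‖ := by
  have h2 : ‖L w‖ ≤ ‖L w + c‖ + ‖c‖ := norm_le_add_norm_add (L w) c
  rw [hL] at h2
  linarith

/-- **The time derivative of the body-frame pairing.**  `U ∈ L¹_loc(ℝ³; ℝ³)`, `Φ` a test field, `R ∈ C¹` a path of linear isometries, `ξ ∈ C¹`: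
`d/dτ ∫ ⟪R(τ)U(w), Φ(R(τ)w + ξ(τ))⟫ dw = ∫ (⟪R′(τ)U(w), Φ(R(τ)w + ξ(τ))⟫ + ⟪R(τ)U(w), DΦ(R(τ)w + ξ(τ))(R′(τ)w + ξ′(τ))⟫) dw`. [folklore] -/
theorem hasDerivAt_integral_inner_rigid_path (hU : LocallyIntegrable U volume) (hξ : ContDiff ℝ 1 ξ)
    (hR : ContDiff ℝ 1 R) (hRi : ∀ τ w, ‖R τ w‖ = ‖w‖)
    {Φ : EuclideanSpace ℝ (Fin 3) → EuclideanSpace ℝ (Fin 3)} (hΦ : IsTestFunctionOn (⊤ : Opens (EuclideanSpace ℝ (Fin 3))) Φ)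
    (τ₀ : ℝ) :
    HasDerivAt (fun τ : ℝ => ∫ w, ⟪R τ (U w), Φ (R τ w + ξ τ)⟫)
      (∫ w, (⟪deriv R τ₀ (U w), Φ (R τ₀ w + ξ τ₀)⟫ +
        ⟪R τ₀ (U w), (fderiv ℝ Φ (R τ₀ w + ξ τ₀)) (deriv R τ₀ w + deriv ξ τ₀)⟫)) τ₀ := by
  have hΦc : Continuous Φ := hΦ.contDiff.continuous
  have hΦd : Differentiable ℝ Φ := hΦ.contDiff.differentiable (by simp)
  have hDΦc : Continuous (fderiv ℝ Φ) := hΦ.contDiff.continuous_fderiv (by simp)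
  have hDΦs : HasCompactSupport (fderiv ℝ Φ) := hΦ.hasCompactSupport.fderiv (𝕜 := ℝ)
  have hξc : Continuous ξ := hξ.continuous
  have hξd : Differentiable ℝ ξ := hξ.differentiable (by simp)
  have hξ'c : Continuous (deriv ξ) := hξ.continuous_deriv le_rfl
  have hRc : Continuous R := hR.continuous
  have hRd : Differentiable ℝ R := hR.differentiable (by simp)
  have hR'c : Continuous (deriv R) := hR.continuous_deriv le_rfl
  obtain ⟨M₀, hM₀⟩ := hΦc.bounded_above_of_compact_support hΦ.hasCompactSupport
  obtain ⟨M₁, hM₁⟩ := hDΦc.bounded_above_of_compact_support hDΦs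
  have hM₀0 : 0 ≤ M₀ := (norm_nonneg _).trans (hM₀ 0)
  have hM₁0 : 0 ≤ M₁ := (norm_nonneg _).trans (hM₁ 0)
  obtain ⟨R₀, hR₀0, hR₀⟩ := (hΦ.hasCompactSupport.isCompact.isBounded).subset_closedBall_lt 0 (0 : EuclideanSpace ℝ (Fin 3))
  -- bounds for `ξ`, `ξ'`, `R'` on the time window `[τ₀ − 1, τ₀ + 1]`
  obtain ⟨Mξ, hMξ⟩ := (isCompact_Icc (a := τ₀ - 1) (b := τ₀ + 1)).exists_bound_of_continuousOn hξc.continuousOn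
  obtain ⟨Mξ', hMξ'⟩ := (isCompact_Icc (a := τ₀ - 1) (b := τ₀ + 1)).exists_bound_of_continuousOn hξ'c.continuousOn
  obtain ⟨MR', hMR'⟩ := (isCompact_Icc (a := τ₀ - 1) (b := τ₀ + 1)).exists_bound_of_continuousOn hR'c.continuousOn
  have hMξ0 : 0 ≤ Mξ := (norm_nonneg _).trans (hMξ τ₀ ⟨by linarith, by linarith⟩)
  have hMξ'0 : 0 ≤ Mξ' := (norm_nonneg _).trans (hMξ' τ₀ ⟨by linarith, by linarith⟩)
  have hMR'0 : 0 ≤ MR' := (norm_nonneg _).trans (hMR' τ₀ ⟨by linarith, by linarith⟩)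
  have hball : ∀ t ∈ ball τ₀ (1 : ℝ), t ∈ Icc (τ₀ - 1) (τ₀ + 1) := fun t ht => by
    have h := mem_ball_iff_norm.1 ht
    rw [Real.norm_eq_abs, abs_lt] at h
    exact ⟨by linarith, by linarith⟩
  set F' : ℝ → EuclideanSpace ℝ (Fin 3) → ℝ := fun t w =>
    ⟪deriv R t (U w), Φ (R t w + ξ t)⟫ + ⟪R t (U w), (fderiv ℝ Φ (R t w + ξ t)) (deriv R t w + deriv ξ t)⟫ with hF'
  set K : Set (EuclideanSpace ℝ (Fin 3)) := closedBall 0 (R₀ + Mξ) with hK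
  have hKc : IsCompact K := isCompact_closedBall _ _
  set C₀ : ℝ := MR' * M₀ + M₁ * (MR' * (R₀ + Mξ) + Mξ') with hC₀
  set bound : EuclideanSpace ℝ (Fin 3) → ℝ := K.indicator fun w => C₀ * ‖U w‖ with hbound
  have hbound_int : Integrable bound volume := by
    rw [hbound, integrable_indicator_iff hKc.measurableSet]
    exact ((hU.integrableOn_isCompact hKc).norm.const_mul C₀)
  -- off `K` the moving argument misses the support of `Φ` (for times in the window)
  have hoff : ∀ t ∈ Icc (τ₀ - 1) (τ₀ + 1), ∀ w ∉ K, Φ (R t w + ξ t) = 0 ∧ fderiv ℝ Φ (R t w + ξ t) = 0 := by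
    intro t ht w hw
    have hzt : R t w + ξ t ∉ tsupport Φ := by
      intro hmem
      have h1 := norm_le_of_rigid_mem (hRi t) (mem_closedBall_zero_iff.1 (hR₀ hmem))
      exact hw (mem_closedBall_zero_iff.2 (h1.trans (by linarith [hMξ t ht])))
    refine ⟨image_eq_zero_of_notMem_tsupport hzt, ?_⟩
    by_contra hne
    exact hzt (support_fderiv_subset ℝ (mem_support.2 hne))
  -- measurability
  have hRU : ∀ t : ℝ, AEStronglyMeasurable (fun w => R t (U w)) volume := fun t =>
    (R t).continuous.comp_aestronglyMeasurable hU.aestronglyMeasurable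
  have hR'U : ∀ t : ℝ, AEStronglyMeasurable (fun w => deriv R t (U w)) volume := fun t =>
    (deriv R t).continuous.comp_aestronglyMeasurable hU.aestronglyMeasurable
  have harg : ∀ t : ℝ, Continuous fun w : EuclideanSpace ℝ (Fin 3) => R t w + ξ t := fun t =>
    (R t).continuous.add continuous_const
  have hF_meas : ∀ t : ℝ, AEStronglyMeasurable (fun w => ⟪R t (U w), Φ (R t w + ξ t)⟫) volume := fun t =>
    (hRU t).inner (hΦc.comp (harg t)).aestronglyMeasurable
  have hF_int : Integrable (fun w => ⟪R τ₀ (U w), Φ (R τ₀ w + ξ τ₀)⟫) volume := by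
    have hRUl : LocallyIntegrable (fun w => R τ₀ (U w)) volume := by
      have h := (R τ₀).locallyIntegrableOn_comp (locallyIntegrableOn_univ.2 hU)
      exact locallyIntegrableOn_univ.1 h
    refine integrable_inner_of_locallyIntegrable_of_hasCompactSupport hRUl (hΦc.comp (harg τ₀)) ?_
    refine HasCompactSupport.intro hKc fun w hw => ?_
    exact (hoff τ₀ ⟨by linarith, by linarith⟩ w hw).1
  have hF'_meas : AEStronglyMeasurable (F' τ₀) volume := by
    refine ((hR'U τ₀).inner (hΦc.comp (harg τ₀)).aestronglyMeasurable).add ((hRU τ₀).inner ?_)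
    exact ((hDΦc.comp (harg τ₀)).clm_apply ((deriv R τ₀).continuous.add continuous_const)).aestronglyMeasurable
  have h_bound : ∀ᵐ w ∂(volume : Measure (EuclideanSpace ℝ (Fin 3))), ∀ t ∈ ball τ₀ (1 : ℝ), ‖F' t w‖ ≤ bound w := by
    refine ae_of_all _ fun w t ht => ?_
    have htI := hball t ht
    by_cases hw : w ∈ K
    · rw [hbound, indicator_of_mem hw, hF']
      have hwR : ‖w‖ ≤ R₀ + Mξ := mem_closedBall_zero_iff.1 hw
      have h1 : ‖⟪deriv R t (U w), Φ (R t w + ξ t)⟫‖ ≤ MR' * M₀ * ‖U w‖ := by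
        calc ‖⟪deriv R t (U w), Φ (R t w + ξ t)⟫‖ ≤ ‖deriv R t (U w)‖ * ‖Φ (R t w + ξ t)‖ := norm_inner_le_norm _ _
          _ ≤ (‖deriv R t‖ * ‖U w‖) * M₀ := mul_le_mul ((deriv R t).le_opNorm _) (hM₀ _) (norm_nonneg _) (by positivity)
          _ ≤ (MR' * ‖U w‖) * M₀ := mul_le_mul_of_nonneg_right (mul_le_mul_of_nonneg_right (hMR' t htI) (norm_nonneg _)) hM₀0
          _ = MR' * M₀ * ‖U w‖ := by ring
      have h2 : ‖⟪R t (U w), (fderiv ℝ Φ (R t w + ξ t)) (deriv R t w + deriv ξ t)⟫‖ ≤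
          M₁ * (MR' * (R₀ + Mξ) + Mξ') * ‖U w‖ := by
        have h3 : ‖deriv R t w + deriv ξ t‖ ≤ MR' * (R₀ + Mξ) + Mξ' := by
          calc ‖deriv R t w + deriv ξ t‖ ≤ ‖deriv R t w‖ + ‖deriv ξ t‖ := norm_add_le _ _
            _ ≤ ‖deriv R t‖ * ‖w‖ + Mξ' := add_le_add ((deriv R t).le_opNorm _) (hMξ' t htI)
            _ ≤ MR' * (R₀ + Mξ) + Mξ' := by gcongr; exact hMR' t htI
        calc ‖⟪R t (U w), (fderiv ℝ Φ (R t w + ξ t)) (deriv R t w + deriv ξ t)⟫‖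
            ≤ ‖R t (U w)‖ * ‖(fderiv ℝ Φ (R t w + ξ t)) (deriv R t w + deriv ξ t)‖ := norm_inner_le_norm _ _
          _ ≤ ‖U w‖ * (M₁ * (MR' * (R₀ + Mξ) + Mξ')) := by
              rw [hRi]
              gcongr
              exact (ContinuousLinearMap.le_opNorm _ _).trans (mul_le_mul (hM₁ _) h3 (norm_nonneg _) hM₁0)
          _ = M₁ * (MR' * (R₀ + Mξ) + Mξ') * ‖U w‖ := by ring
      calc ‖⟪deriv R t (U w), Φ (R t w + ξ t)⟫ + ⟪R t (U w), (fderiv ℝ Φ (R t w + ξ t)) (deriv R t w + deriv ξ t)⟫‖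
          ≤ MR' * M₀ * ‖U w‖ + M₁ * (MR' * (R₀ + Mξ) + Mξ') * ‖U w‖ := (norm_add_le _ _).trans (add_le_add h1 h2)
        _ = C₀ * ‖U w‖ := by rw [hC₀]; ring
    · obtain ⟨h0, hD0⟩ := hoff t htI w hw
      rw [hbound, indicator_of_notMem hw]
      simp only [hF', h0, hD0, zero_apply, inner_zero_right, add_zero, norm_zero, le_refl]
  have h_diff : ∀ᵐ w ∂(volume : Measure (EuclideanSpace ℝ (Fin 3))), ∀ t ∈ ball τ₀ (1 : ℝ),
      HasDerivAt (fun t : ℝ => ⟪R t (U w), Φ (R t w + ξ t)⟫) (F' t w) t := by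
    refine ae_of_all _ fun w t _ => ?_
    have hf : HasDerivAt (fun t : ℝ => R t (U w)) (deriv R t (U w)) t := by
      have h := (hRd t).hasDerivAt.clm_apply (hasDerivAt_const t (U w))
      simpa using h
    have h1 : HasDerivAt (fun t : ℝ => R t w) (deriv R t w) t := by
      have h := (hRd t).hasDerivAt.clm_apply (hasDerivAt_const t w)
      simpa using h
    have hpath : HasDerivAt (fun t : ℝ => R t w + ξ t) (deriv R t w + deriv ξ t) t := h1.add (hξd t).hasDerivAt
    have hg : HasDerivAt (fun t : ℝ => Φ (R t w + ξ t)) ((fderiv ℝ Φ (R t w + ξ t)) (deriv R t w + deriv ξ t)) t :=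
      (hΦd _).hasFDerivAt.comp_hasDerivAt t hpath
    refine (hf.inner ℝ hg).congr_deriv ?_
    simp only [hF', map_add, inner_add_right]
    ring
  exact (hasDerivAt_integral_of_dominated_loc_of_deriv_le (ball_mem_nhds τ₀ one_pos)
    (Eventually.of_forall hF_meas) hF_int hF'_meas h_bound hbound_int h_diff).2

/-- **Continuity of the body-frame pairings of the derivative shape** `τ ↦ ∫ ⟪L(τ) U(w), Ψ(R(τ)w + ξ(τ)) (A(τ) w + a(τ))⟫ dw` (`U ∈ L¹_loc`, `Ψ` a continuous
compactly supported operator field, `R` a continuous path of isometries, `L`, `A` continuous operator paths, `ξ`, `a` continuous). [folklore] -/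
theorem continuous_integral_inner_rigid_clm_path (hU : LocallyIntegrable U volume) (hξ : Continuous ξ)
    (hRc : Continuous R) (hRi : ∀ τ w, ‖R τ w‖ = ‖w‖)
    {L A : ℝ → EuclideanSpace ℝ (Fin 3) →L[ℝ] EuclideanSpace ℝ (Fin 3)} (hL : Continuous L) (hA : Continuous A)
    {a : ℝ → EuclideanSpace ℝ (Fin 3)} (ha : Continuous a)
    {Ψ : EuclideanSpace ℝ (Fin 3) → EuclideanSpace ℝ (Fin 3) →L[ℝ] EuclideanSpace ℝ (Fin 3)} (hΨ : Continuous Ψ)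
    (hΨc : HasCompactSupport Ψ) :
    Continuous fun τ : ℝ => ∫ w, ⟪L τ (U w), Ψ (R τ w + ξ τ) (A τ w + a τ)⟫ := by
  refine continuous_iff_continuousAt.2 fun τ₀ => ?_
  obtain ⟨M₁, hM₁⟩ := hΨ.bounded_above_of_compact_support hΨc
  have hM₁0 : 0 ≤ M₁ := (norm_nonneg _).trans (hM₁ 0)
  obtain ⟨R₀, hR₀0, hR₀⟩ := hΨc.isCompact.isBounded.subset_closedBall_lt 0 (0 : EuclideanSpace ℝ (Fin 3))
  obtain ⟨Mξ, hMξ⟩ := (isCompact_Icc (a := τ₀ - 1) (b := τ₀ + 1)).exists_bound_of_continuousOn hξ.continuousOn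
  obtain ⟨Ma, hMa⟩ := (isCompact_Icc (a := τ₀ - 1) (b := τ₀ + 1)).exists_bound_of_continuousOn ha.continuousOn
  obtain ⟨ML, hML⟩ := (isCompact_Icc (a := τ₀ - 1) (b := τ₀ + 1)).exists_bound_of_continuousOn hL.continuousOn
  obtain ⟨MA, hMA⟩ := (isCompact_Icc (a := τ₀ - 1) (b := τ₀ + 1)).exists_bound_of_continuousOn hA.continuousOn
  have hMa0 : 0 ≤ Ma := (norm_nonneg _).trans (hMa τ₀ ⟨by linarith, by linarith⟩)
  have hML0 : 0 ≤ ML := (norm_nonneg _).trans (hML τ₀ ⟨by linarith, by linarith⟩)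
  have hMA0 : 0 ≤ MA := (norm_nonneg _).trans (hMA τ₀ ⟨by linarith, by linarith⟩)
  have hMξ0 : 0 ≤ Mξ := (norm_nonneg _).trans (hMξ τ₀ ⟨by linarith, by linarith⟩)
  have hball : ∀ t ∈ ball τ₀ (1 : ℝ), t ∈ Icc (τ₀ - 1) (τ₀ + 1) := fun t ht => by
    have h := mem_ball_iff_norm.1 ht
    rw [Real.norm_eq_abs, abs_lt] at h
    exact ⟨by linarith, by linarith⟩
  set K : Set (EuclideanSpace ℝ (Fin 3)) := closedBall 0 (R₀ + Mξ) with hK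
  have hKc : IsCompact K := isCompact_closedBall _ _
  set C₀ : ℝ := ML * (M₁ * (MA * (R₀ + Mξ) + Ma)) with hC₀
  set bound : EuclideanSpace ℝ (Fin 3) → ℝ := K.indicator fun w => C₀ * ‖U w‖ with hbound
  have hbound_int : Integrable bound volume := by
    rw [hbound, integrable_indicator_iff hKc.measurableSet]
    exact ((hU.integrableOn_isCompact hKc).norm.const_mul C₀)
  have hF_meas : ∀ t : ℝ, AEStronglyMeasurable (fun w => ⟪L t (U w), Ψ (R t w + ξ t) (A t w + a t)⟫) volume := fun t =>
    ((L t).continuous.comp_aestronglyMeasurable hU.aestronglyMeasurable).inner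
      ((hΨ.comp ((R t).continuous.add continuous_const)).clm_apply ((A t).continuous.add continuous_const)).aestronglyMeasurable
  refine continuousAt_of_dominated (Eventually.of_forall hF_meas) ?_ hbound_int ?_
  · filter_upwards [ball_mem_nhds τ₀ one_pos] with t ht
    refine ae_of_all _ fun w => ?_
    have htI := hball t ht
    by_cases hw : w ∈ K
    · rw [hbound, indicator_of_mem hw]
      have hwR : ‖w‖ ≤ R₀ + Mξ := mem_closedBall_zero_iff.1 hw
      have h3 : ‖A t w + a t‖ ≤ MA * (R₀ + Mξ) + Ma := by
        calc ‖A t w + a t‖ ≤ ‖A t w‖ + ‖a t‖ := norm_add_le _ _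
          _ ≤ ‖A t‖ * ‖w‖ + Ma := add_le_add ((A t).le_opNorm _) (hMa t htI)
          _ ≤ MA * (R₀ + Mξ) + Ma := by gcongr; exact hMA t htI
      calc ‖⟪L t (U w), Ψ (R t w + ξ t) (A t w + a t)⟫‖ ≤ ‖L t (U w)‖ * ‖Ψ (R t w + ξ t) (A t w + a t)‖ := norm_inner_le_norm _ _
        _ ≤ (‖L t‖ * ‖U w‖) * (M₁ * (MA * (R₀ + Mξ) + Ma)) :=
            mul_le_mul ((L t).le_opNorm _) ((ContinuousLinearMap.le_opNorm _ _).trans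
              (mul_le_mul (hM₁ _) h3 (norm_nonneg _) hM₁0)) (norm_nonneg _) (by positivity)
        _ ≤ (ML * ‖U w‖) * (M₁ * (MA * (R₀ + Mξ) + Ma)) :=
            mul_le_mul_of_nonneg_right (mul_le_mul_of_nonneg_right (hML t htI) (norm_nonneg _))
              (mul_nonneg hM₁0 (add_nonneg (mul_nonneg hMA0 (by linarith)) hMa0))
        _ = C₀ * ‖U w‖ := by rw [hC₀]; ring
    · have hΨ0 : Ψ (R t w + ξ t) = 0 := by
        by_contra hne
        have h1 := norm_le_of_rigid_mem (hRi t) (mem_closedBall_zero_iff.1 (hR₀ (subset_tsupport _ (mem_support.2 hne))))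
        exact hw (mem_closedBall_zero_iff.2 (h1.trans (by linarith [hMξ t htI])))
      rw [hbound, indicator_of_notMem hw, hΨ0]
      simp
  · refine ae_of_all _ fun w => ?_
    have h1 : Continuous fun t : ℝ => L t (U w) := hL.clm_apply continuous_const
    have h2 : Continuous fun t : ℝ => R t w + ξ t := (hRc.clm_apply continuous_const).add hξ
    have h3 : Continuous fun t : ℝ => A t w + a t := (hA.clm_apply continuous_const).add ha
    exact (h1.inner ((hΨ.comp h2).clm_apply h3)).continuousAt

end RigidFrame

end Summit.NavierStokesRegularity.NavierStokesRegularity.Theorems.PowerGaugeEulerLiouville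

end
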